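import Literature.NumberTheory.ConnesConsani2021.QuasiInnerArchInjective
import HarnessLib

/-!
# Connes–Consani 2021 (JNT 226), §3: `H²` boundary values, multipliers and finite Blaschke division

LABEL: RH-FREE (every statement below is unconditional function theory on the circle; `bears_on: W-C/W-P` —
infrastructure for the typed fact `QuasiInner.prop_3_7` (the kernel of `(1 − 𝒫)ρ(u_p)𝒫` is `B_p H²`)).
WHAT THIS IS NOT: no statement about zeros of `ζ`, no spectral realization, nothing here bears on the truth
of RH.

Contents (theorems only; no new definitions, no new named facts):
* M1 `boundary_of_differentiableOn_ball`: a function holomorphic on a disc of radius `> 1` has boundary values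
  in `H²`, vanishing negative Fourier coefficients, and `⟨η_x | U|_{S¹}⟩ = U(x)` (`|x| < 1`).
* M2 `mulOp_mem_hardySpace_of_inner_neg_eq_zero`, `inner_etaVec_mulOp`: continuous functions with vanishing
  negative Fourier coefficients are multipliers of `H²` and evaluation `f ↦ ⟨η_x | f⟩` is multiplicative.
* M3 the single Blaschke factor `b_α` (`blaschkeFactor`, as printed in [CC21, §3]): holomorphy across `S¹`,
  unimodularity on `S¹`, its Fourier expansion.
* M4/M5 F. Riesz division: if `f ∈ H²` vanishes at the (finitely many, nonzero) `α ∈ s` then `B̄_s f ∈ H²`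
  and `f = B_s (B̄_s f)`; finite Blaschke products are `H²`-multipliers with multiplicative evaluation.

## References
* [CC21] A. Connes, C. Consani, *Quasi-inner functions and local factors*, J. Number Theory 226 (2021),
  arXiv:2008.10974 — §3, Prop. 3.7 and its proof (bib key `ConnesConsani2021QuasiInner`).
* W. Rudin, *Real and Complex Analysis*, Thm 17.9 (F. Riesz factorization), as cited in [CC21, §3].
-/

noncomputable section

open _root_.MeasureTheory _root_.Complex AddCircle Filter Set Metric
open scoped Real NNReal ENNReal InnerProductSpace Topology ComplexConjugate

namespace Literature.NumberTheory.ConnesConsani2021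

namespace QuasiInner

/-! ### M1. Functions holomorphic across `S¹`: Taylor coefficients = Fourier coefficients -/

/-- RH-FREE. A function holomorphic on a disc of radius `> 1` has absolutely summable Taylor
coefficients `q_k` with `U(y) = Σ q_k y^k` on the closed unit disc. [folklore] -/
private theorem exists_taylorCoeff_of_differentiableOn_ball {U : ℂ → ℂ} {R : ℝ} (hR : 1 < R)
    (hU : DifferentiableOn ℂ U (ball 0 R)) :
    ∃ q : ℕ → ℂ, Summable (fun k => ‖q k‖) ∧ ∀ y : ℂ, ‖y‖ ≤ 1 → HasSum (fun k => q k * y ^ k) (U y) := by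
  set ρ : ℝ≥0 := ⟨(1 + R) / 2, by positivity⟩ with hρ
  have hρ1 : (1:ℝ) < ρ := by
    show (1:ℝ) < (1 + R) / 2; linarith
  have hρR : (ρ:ℝ) < R := by
    show (1 + R) / 2 < R; linarith
  have hd : DifferentiableOn ℂ U (closedBall 0 ρ) := hU.mono (closedBall_subset_ball hρR)
  have hps := hd.hasFPowerSeriesOnBall (by exact_mod_cast (zero_lt_one.trans hρ1) : 0 < ρ)
  set p := cauchyPowerSeries U 0 ρ with hp
  -- an intermediate radius `1 < ρ' < ρ`
  set ρ' : ℝ≥0 := ⟨(1 + ρ) / 2, by positivity⟩ with hρ'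
  have hρ'1 : (1:ℝ) < ρ' := by
    show (1:ℝ) < (1 + ρ) / 2; linarith
  have hρ'ρ : (ρ':ℝ) < ρ := by
    show (1 + (ρ:ℝ)) / 2 < ρ; linarith
  have hrad : (ρ' : ℝ≥0∞) < p.radius := by
    refine lt_of_lt_of_le ?_ hps.r_le
    exact_mod_cast hρ'ρ
  obtain ⟨C, hCpos, hC⟩ := p.norm_mul_pow_le_of_lt_radius hrad
  have hC0 : 0 ≤ C := hCpos.le
  refine ⟨fun k => p.coeff k, ?_, ?_⟩
  · -- `‖q_k‖ ≤ C ρ'^{-k}`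
    have hρ'pos : (0:ℝ) < ρ' := zero_lt_one.trans hρ'1
    have hgeo : Summable fun k : ℕ => C * ((ρ':ℝ)⁻¹) ^ k :=
      (summable_geometric_of_lt_one (by positivity) (inv_lt_one_of_one_lt₀ hρ'1)).mul_left C
    refine hgeo.of_nonneg_of_le (fun k => norm_nonneg _) fun k => ?_
    have h1 := hC k
    rw [FormalMultilinearSeries.norm_apply_eq_norm_coef] at h1
    rw [inv_pow, ← div_eq_mul_inv, le_div_iff₀ (pow_pos hρ'pos k)]
    exact h1
  · intro y hy
    have hy' : y ∈ Metric.eball (0:ℂ) ρ := by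
      rw [Metric.mem_eball, edist_zero_right, enorm_eq_nnnorm, ENNReal.coe_lt_coe, ← NNReal.coe_lt_coe,
        coe_nnnorm]
      exact lt_of_le_of_lt hy hρ1
    have h := hps.hasSum hy'
    simp only [zero_add, FormalMultilinearSeries.apply_eq_pow_smul_coeff, smul_eq_mul] at h
    exact h.congr_fun fun k => by ring

/-- RH-FREE. The restriction to `S¹` of a function holomorphic on a neighbourhood of the closed disc is
continuous. [folklore] -/
private theorem continuous_circleRestrict_of_differentiableOn_ball {U : ℂ → ℂ} {R : ℝ} (hR : 1 < R)
    (hU : DifferentiableOn ℂ U (ball 0 R)) : Continuous (circleRestrict 1 U) := by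
  have hc : ContinuousOn U (ball 0 R) := hU.continuousOn
  refine hc.comp_continuous (by fun_prop) fun x => ?_
  rw [mem_ball_zero_iff, Circle.norm_coe]; exact hR

/-- RH-FREE. **Holomorphic across `S¹` ⇒ boundary function in `H²` with Fourier coefficients = Taylor
coefficients**: for `U` holomorphic on a disc of radius `> 1`, the boundary function `U|_{S¹}` is
`Σ_{k ≥ 0} q_k e_k` (norm-convergent in `C(S¹)`), with `U(y) = Σ q_k y^k` on the closed disc.  This is the
mechanism «for an holomorphic function one has `(1 − 𝒫)h𝒫 = 0`» (p0006:L87) at the level of coefficients.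
[cite: ConnesConsani2021QuasiInner, §2, before Prop 2.4 (arXiv chunk p0006:L87–L88) and proof of Prop 2.4 (p0007:L8, citing Rudin RCA Thm 17.12)] -/
theorem exists_hasSum_fourier_of_differentiableOn_ball {U : ℂ → ℂ} {R : ℝ} (hR : 1 < R)
    (hU : DifferentiableOn ℂ U (ball 0 R)) :
    ∃ q : ℕ → ℂ, Summable (fun k => ‖q k‖) ∧ (∀ y : ℂ, ‖y‖ ≤ 1 → HasSum (fun k => q k * y ^ k) (U y)) ∧
      HasSum (fun k : ℕ => q k • fourier (T := (1:ℝ)) (k : ℤ))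
        (⟨circleRestrict 1 U, continuous_circleRestrict_of_differentiableOn_ball hR hU⟩ :
          C(AddCircle (1:ℝ), ℂ)) := by
  obtain ⟨q, hq, hqU⟩ := exists_taylorCoeff_of_differentiableOn_ball hR hU
  refine ⟨q, hq, hqU, ?_⟩
  have hsumC : Summable fun k : ℕ => q k • fourier (T := (1:ℝ)) (k : ℤ) := by
    refine Summable.of_norm_bounded hq fun k => ?_
    rw [norm_smul, fourier_norm, mul_one]
  convert hsumC.hasSum using 1
  ext x
  have h1 := (ContinuousMap.evalCLM ℂ x).hasSum hsumC.hasSum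
  simp only [ContinuousMap.evalCLM_apply, ContinuousMap.smul_apply, smul_eq_mul] at h1
  have h2 : HasSum (fun k : ℕ => q k * ((toCircle x : Circle) : ℂ) ^ k) (U (toCircle x)) :=
    hqU _ (by rw [Circle.norm_coe])
  have h3 : (fun k : ℕ => q k * fourier (T := (1:ℝ)) (k : ℤ) x) =
      fun k => q k * ((toCircle x : Circle) : ℂ) ^ k := by
    funext k
    rw [fourier_apply, toCircle_zsmul]; simp
  rw [h3] at h1
  exact h2.unique h1

open Classical in
/-- RH-FREE. Fourier coefficients of an `L²` sum `Σ_j a_j e_{σ j}` (injective `σ`). [folklore] -/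
private theorem inner_fourierLp_of_hasSum_smul {a : ℕ → ℂ} {σ : ℕ → ℤ} (hσ : Function.Injective σ)
    {f : Lp ℂ 2 (haarAddCircle (T := (1:ℝ)))}
    (h : HasSum (fun j => a j • fourierLp (T := (1:ℝ)) 2 (σ j)) f) (i : ℤ) :
    ⟪fourierLp (T := (1:ℝ)) 2 i, f⟫_ℂ = if h' : ∃ j, σ j = i then a h'.choose else 0 := by
  classical
  have h1 := (innerSL ℂ (fourierLp (T := (1:ℝ)) 2 i)).hasSum h
  simp only [innerSL_apply_apply, inner_smul_right] at h1
  have h2 : (fun j => a j * ⟪fourierLp (T := (1:ℝ)) 2 i, fourierLp (T := (1:ℝ)) 2 (σ j)⟫_ℂ) =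
      fun j => if i = σ j then a j else 0 := by
    funext j
    rw [orthonormal_iff_ite.1 (orthonormal_fourier (T := (1:ℝ))) i (σ j)]
    split_ifs <;> simp
  rw [h2] at h1
  by_cases h' : ∃ j, σ j = i
  · rw [dif_pos h']
    have hj := h'.choose_spec
    have h3 : (fun j => if i = σ j then a j else 0) = fun j => if j = h'.choose then a h'.choose else 0 := by
      funext j
      by_cases hji : j = h'.choose
      · subst hji; simp [hj]
      · have : i ≠ σ j := fun h'' => hji (hσ (by rw [hj, ← h'']))
        simp [this, hji]
    rw [h3] at h1
    exact h1.unique (hasSum_ite_eq _ _)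
  · rw [dif_neg h']
    have h3 : (fun j => if i = σ j then a j else 0) = fun _ => 0 := by
      funext j
      have : i ≠ σ j := fun h'' => h' ⟨j, h''.symm⟩
      simp [this]
    rw [h3] at h1
    exact h1.unique hasSum_zero

/-- RH-FREE. **The boundary function of a function holomorphic across `S¹`**: as an `L²(S¹)` vector it lies
in `H²`, its nonnegative Fourier coefficients are the Taylor coefficients and `⟨η_x | U|_{S¹}⟩ = U(x)`
(`|x| < 1`) — pairing with the Szegő kernel evaluates the function.
[cite: ConnesConsani2021QuasiInner, §2, before Prop 2.4 (arXiv chunk p0006:L87–L88); Lemma 2.2 (p0006:L14–L21)] -/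
theorem boundary_of_differentiableOn_ball {U : ℂ → ℂ} {R : ℝ} (hR : 1 < R)
    (hU : DifferentiableOn ℂ U (ball 0 R)) :
    toLpOrZero 2 haarAddCircle (circleRestrict 1 U) ∈ hardySpace 1 ∧
    (∀ k : ℕ, ⟪fourierLp (T := (1:ℝ)) 2 (-(k + 1 : ℤ)),
        toLpOrZero 2 haarAddCircle (circleRestrict 1 U)⟫_ℂ = 0) ∧
    (∀ x : ℂ, ‖x‖ < 1 → ⟪etaVec 1 x, toLpOrZero 2 haarAddCircle (circleRestrict 1 U)⟫_ℂ = U x) := by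
  obtain ⟨q, hq, hqU, hC⟩ := exists_hasSum_fourier_of_differentiableOn_ball hR hU
  set F : C(AddCircle (1:ℝ), ℂ) :=
    ⟨circleRestrict 1 U, continuous_circleRestrict_of_differentiableOn_ball hR hU⟩ with hF
  have hLp : toLpOrZero 2 haarAddCircle (circleRestrict 1 U) =
      ContinuousMap.toLp (E := ℂ) 2 haarAddCircle ℂ F := toLpOrZero_eq_toLp_continuousMap 2 F
  have hL2 : HasSum (fun k : ℕ => q k • fourierLp (T := (1:ℝ)) 2 (k : ℤ))
      (ContinuousMap.toLp (E := ℂ) 2 haarAddCircle ℂ F) := by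
    have h := (ContinuousMap.toLp (E := ℂ) 2 haarAddCircle ℂ).hasSum hC
    simp only [map_smul] at h
    exact h
  have hneg : ∀ k : ℕ, ⟪fourierLp (T := (1:ℝ)) 2 (-(k + 1 : ℤ)),
      ContinuousMap.toLp (E := ℂ) 2 haarAddCircle ℂ F⟫_ℂ = 0 := by
    intro k
    rw [inner_fourierLp_of_hasSum_smul Nat.cast_injective hL2]
    have : ¬ ∃ j : ℕ, (j : ℤ) = -(k + 1 : ℤ) := fun ⟨j, hj⟩ => by omega
    rw [dif_neg this]
  have hpos : ∀ k : ℕ, ⟪fourierLp (T := (1:ℝ)) 2 (k : ℤ),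
      ContinuousMap.toLp (E := ℂ) 2 haarAddCircle ℂ F⟫_ℂ = q k := by
    intro k
    rw [inner_fourierLp_of_hasSum_smul Nat.cast_injective hL2]
    have h' : ∃ j : ℕ, (j : ℤ) = (k : ℤ) := ⟨k, rfl⟩
    rw [dif_pos h']
    have := h'.choose_spec
    have hjk : h'.choose = k := by exact_mod_cast this
    rw [hjk]
  rw [hLp]
  refine ⟨(mem_hardySpace_iff 1 _).2 hneg, hneg, fun x hx => ?_⟩
  have h1 := inner_etaVec_eq_tsum x hx (ContinuousMap.toLp (E := ℂ) 2 haarAddCircle ℂ F)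
  simp only [hpos] at h1
  exact h1.unique ((hqU x hx.le).congr_fun fun k => by ring)

/-! ### M2. Multipliers: `H^∞`-boundary functions act on `H²`, and `⟨η_x | u·h⟩ = U(x)⟨η_x | h⟩` -/

/-- RH-FREE. `H² = \overline{span}{e_k : k ≥ 0}`. [cite: ConnesConsani2021QuasiInner, Introduction, Definition (arXiv chunk p0003:L5)] -/
theorem hardySpace_eq_topologicalClosure_span :
    hardySpace 1 = (Submodule.span ℂ (Set.range fun k : ℕ => fourierLp (T := (1:ℝ)) 2 (k : ℤ))).topologicalClosure := by
  apply le_antisymm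
  · intro f hf
    -- `f = Σ_{k ≥ 0} f̂(k) e_k`
    have hall := hasSum_fourier_series_L2 (T := (1:ℝ)) f
    have hsupp : ∀ i : ℤ, i ∉ Set.range (Nat.cast : ℕ → ℤ) →
        fourierCoeff (T := (1:ℝ)) f i • fourierLp (T := (1:ℝ)) 2 i = 0 := by
      intro i hi
      have hi' : i < 0 := by
        by_contra h
        push Not at h
        exact hi ⟨i.toNat, by omega⟩
      rw [(mem_hardySpace_iff_fourierCoeff 1 f).1 hf i hi', zero_smul]
    have hN : HasSum (fun k : ℕ => fourierCoeff (T := (1:ℝ)) f k • fourierLp (T := (1:ℝ)) 2 (k : ℤ)) f :=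
      (Function.Injective.hasSum_iff Nat.cast_injective (fun i hi => hsupp i hi)).2 hall
    refine mem_closure_of_tendsto hN.tendsto_sum_nat (Eventually.of_forall fun N => ?_)
    exact Submodule.sum_mem _ fun k _ => Submodule.smul_mem _ _ (Submodule.subset_span ⟨k, rfl⟩)
  · refine Submodule.topologicalClosure_minimal _ ?_ (Submodule.isClosed_orthogonal _)
    rw [Submodule.span_le]
    rintro _ ⟨k, rfl⟩
    exact fourierLp_natCast_mem_hardySpace 1 k

/-- RH-FREE. The Fourier coefficients of the `L^∞`-class of a continuous function. [folklore] -/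
private theorem fourierCoeff_toLp_top (F : C(AddCircle (1:ℝ), ℂ)) (i : ℤ) :
    fourierCoeff (T := (1:ℝ)) ((ContinuousMap.toLp (E := ℂ) ∞ haarAddCircle ℂ F :
      Lp ℂ ∞ (haarAddCircle (T := (1:ℝ)))) : AddCircle (1:ℝ) → ℂ) i = fourierCoeff (T := (1:ℝ)) F i := by
  simp only [fourierCoeff]
  exact integral_congr_ae (by
    filter_upwards [ContinuousMap.coeFn_toLp (p := ∞) (𝕜 := ℂ) haarAddCircle F] with x hx
    simp only [hx])

/-- RH-FREE. The Fourier coefficients of a continuous function are its coordinates in the Fourier basis of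
`L²`. [folklore] -/
private theorem fourierCoeff_eq_inner_toLp (F : C(AddCircle (1:ℝ), ℂ)) (i : ℤ) :
    fourierCoeff (T := (1:ℝ)) F i =
      ⟪fourierLp (T := (1:ℝ)) 2 i, ContinuousMap.toLp (E := ℂ) 2 haarAddCircle ℂ F⟫_ℂ := by
  rw [← coe_fourierBasis, ← fourierBasis.repr_apply_apply, fourierBasis_repr]
  simp only [fourierCoeff]
  exact integral_congr_ae (by
    filter_upwards [ContinuousMap.coeFn_toLp (p := 2) (𝕜 := ℂ) haarAddCircle F] with x hx
    simp only [hx])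

/-- RH-FREE. **`H^∞`-boundary functions are multipliers of `H²`** («for an holomorphic function one has
`(1 − 𝒫)h𝒫 = 0`»): if the continuous `u` on `S¹` has vanishing negative Fourier coefficients then
`u · h ∈ H²` for every `h ∈ H²`.
[cite: ConnesConsani2021QuasiInner, §2, before Prop 2.4 (arXiv chunk p0006:L87–L88)] -/
theorem mulOp_mem_hardySpace_of_inner_neg_eq_zero (F : C(AddCircle (1:ℝ), ℂ))
    (hF : ∀ k : ℕ, ⟪fourierLp (T := (1:ℝ)) 2 (-(k + 1 : ℤ)),
      ContinuousMap.toLp (E := ℂ) 2 haarAddCircle ℂ F⟫_ℂ = 0)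
    {h : Lp ℂ 2 (haarAddCircle (T := (1:ℝ)))} (hh : h ∈ hardySpace 1) :
    mulOp haarAddCircle (ContinuousMap.toLp (E := ℂ) ∞ haarAddCircle ℂ F) h ∈ hardySpace 1 := by
  have hu : ∀ k : ℕ, fourierCoeff (T := (1:ℝ)) ((ContinuousMap.toLp (E := ℂ) ∞ haarAddCircle ℂ F :
      Lp ℂ ∞ (haarAddCircle (T := (1:ℝ)))) : AddCircle (1:ℝ) → ℂ) (-(k + 1 : ℤ)) = 0 := by
    intro k
    rw [fourierCoeff_toLp_top, fourierCoeff_eq_inner_toLp, hF]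
  have h0 := hardyOffDiag_eq_zero_of_fourierCoeff_neg_eq_zero 1 _ hu
  -- `(1 − 𝒫) (u · 𝒫h) = 0` with `𝒫h = h`
  have h1 : hardyOffDiag 1 (ContinuousMap.toLp (E := ℂ) ∞ haarAddCircle ℂ F) h = 0 := by
    rw [h0]; rfl
  have h2 : hardyProjection 1 h = h := by
    rw [hardyProjection]; exact Submodule.starProjection_eq_self_iff.2 hh
  have h3 : (1 - hardyProjection 1) (mulOp haarAddCircle (ContinuousMap.toLp (E := ℂ) ∞ haarAddCircle ℂ F) h)
      = 0 := by
    have e : hardyOffDiag 1 (ContinuousMap.toLp (E := ℂ) ∞ haarAddCircle ℂ F) h =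
        (1 - hardyProjection 1) (mulOp haarAddCircle (ContinuousMap.toLp (E := ℂ) ∞ haarAddCircle ℂ F)
          (hardyProjection 1 h)) := rfl
    have h5 := h1
    rw [e, h2] at h5
    exact h5
  have h4 : mulOp haarAddCircle (ContinuousMap.toLp (E := ℂ) ∞ haarAddCircle ℂ F) h =
      hardyProjection 1 (mulOp haarAddCircle (ContinuousMap.toLp (E := ℂ) ∞ haarAddCircle ℂ F) h) := by
    have h6 : mulOp haarAddCircle (ContinuousMap.toLp (E := ℂ) ∞ haarAddCircle ℂ F) h -
        hardyProjection 1 (mulOp haarAddCircle (ContinuousMap.toLp (E := ℂ) ∞ haarAddCircle ℂ F) h) = 0 := h3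
    exact sub_eq_zero.1 h6
  rw [h4, hardyProjection]
  exact Submodule.starProjection_apply_mem _ _

/-- RH-FREE. Fourier coefficients of `u · e_k`: `⟨e_j | u e_k⟩ = ⟨e_{j−k} | u⟩`. [folklore] -/
private theorem inner_fourierLp_toLp_mul_fourier (F : C(AddCircle (1:ℝ), ℂ)) (j k : ℤ) :
    ⟪fourierLp (T := (1:ℝ)) 2 j, ContinuousMap.toLp (E := ℂ) 2 haarAddCircle ℂ (F * fourier k)⟫_ℂ =
      ⟪fourierLp (T := (1:ℝ)) 2 (j - k), ContinuousMap.toLp (E := ℂ) 2 haarAddCircle ℂ F⟫_ℂ := by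
  rw [← fourierCoeff_eq_inner_toLp, ← fourierCoeff_eq_inner_toLp]
  simp only [fourierCoeff, ContinuousMap.coe_mul, Pi.mul_apply, smul_eq_mul]
  refine integral_congr_ae (ae_of_all _ fun x => ?_)
  have e : fourier (T := (1:ℝ)) (-(j - k)) x = fourier (T := (1:ℝ)) (-j) x * fourier (T := (1:ℝ)) k x := by
    rw [show -(j - k) = -j + k by ring, fourier_add]
  show fourier (T := (1:ℝ)) (-j) x * (F x * fourier (T := (1:ℝ)) k x) = fourier (T := (1:ℝ)) (-(j - k)) x * F x
  rw [e]; ring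

/-- RH-FREE. **Evaluation is multiplicative**: for a continuous `u` on `S¹` with vanishing negative Fourier
coefficients and `h ∈ H²`, `⟨η_x | u·h⟩ = Û(x)·⟨η_x | h⟩` where `Û(x) = ⟨η_x | u⟩ = Σ û(k) x^k` is the
holomorphic extension of `u` («the product `ι(v) = κ_p(v)B_p(v)`…», multiplicativity of boundary values).
[cite: ConnesConsani2021QuasiInner, Prop 3.7 (i)–(ii), proof (arXiv chunk p0009:L54–p0010:L4)] -/
theorem inner_etaVec_mulOp (F : C(AddCircle (1:ℝ), ℂ))
    (hF : ∀ k : ℕ, ⟪fourierLp (T := (1:ℝ)) 2 (-(k + 1 : ℤ)),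
      ContinuousMap.toLp (E := ℂ) 2 haarAddCircle ℂ F⟫_ℂ = 0)
    {x : ℂ} (hx : ‖x‖ < 1) {h : Lp ℂ 2 (haarAddCircle (T := (1:ℝ)))} (hh : h ∈ hardySpace 1) :
    ⟪etaVec 1 x, mulOp haarAddCircle (ContinuousMap.toLp (E := ℂ) ∞ haarAddCircle ℂ F) h⟫_ℂ =
      ⟪etaVec 1 x, ContinuousMap.toLp (E := ℂ) 2 haarAddCircle ℂ F⟫_ℂ * ⟪etaVec 1 x, h⟫_ℂ := by
  -- both sides are continuous linear in `h`; compare them on the modes `e_k`, `k ≥ 0`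
  set M := mulOp haarAddCircle (ContinuousMap.toLp (E := ℂ) ∞ haarAddCircle ℂ F) with hM
  set Ux := ⟪etaVec 1 x, ContinuousMap.toLp (E := ℂ) 2 haarAddCircle ℂ F⟫_ℂ with hUx
  let L₁ : Lp ℂ 2 (haarAddCircle (T := (1:ℝ))) →L[ℂ] ℂ := (innerSL ℂ (etaVec 1 x)).comp M
  let L₂ : Lp ℂ 2 (haarAddCircle (T := (1:ℝ))) →L[ℂ] ℂ := Ux • innerSL ℂ (etaVec 1 x)
  have hmodes : ∀ k : ℕ, L₁ (fourierLp (T := (1:ℝ)) 2 (k : ℤ)) = L₂ (fourierLp (T := (1:ℝ)) 2 (k : ℤ)) := by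
    intro k
    simp only [L₁, L₂, ContinuousLinearMap.comp_apply, innerSL_apply_apply, smul_apply, smul_eq_mul]
    -- `u · e_k` as the `L²` class of the continuous function `F * fourier k`
    have hMe : M (fourierLp (T := (1:ℝ)) 2 (k : ℤ)) =
        ContinuousMap.toLp (E := ℂ) 2 haarAddCircle ℂ (F * fourier (k : ℤ)) := by
      rw [hM]; exact mulOp_toLp_toLp F (fourier (k : ℤ))
    rw [hMe]
    -- expand both pairings with `η_x` in Fourier modes
    have h1 := inner_etaVec_eq_tsum x hx (ContinuousMap.toLp (E := ℂ) 2 haarAddCircle ℂ (F * fourier (k : ℤ)))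
    have h2 := inner_etaVec_eq_tsum x hx (ContinuousMap.toLp (E := ℂ) 2 haarAddCircle ℂ F)
    rw [← inner_conj_symm (etaVec 1 x) (fourierLp (T := (1:ℝ)) 2 (k : ℤ)),
      inner_fourierLp_natCast_etaVec (T := (1:ℝ)) x hx k, map_pow,
      Complex.conj_conj]
    -- `⟨e_j | u e_k⟩ = ⟨e_{j-k} | u⟩`, vanishing for `j < k`
    have hterm : ∀ j : ℕ, x ^ j * ⟪fourierLp (T := (1:ℝ)) 2 (j : ℤ),
        ContinuousMap.toLp (E := ℂ) 2 haarAddCircle ℂ (F * fourier (k : ℤ))⟫_ℂ =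
        if k ≤ j then x ^ k * (x ^ (j - k) * ⟪fourierLp (T := (1:ℝ)) 2 ((j - k : ℕ) : ℤ),
          ContinuousMap.toLp (E := ℂ) 2 haarAddCircle ℂ F⟫_ℂ) else 0 := by
      intro j
      rw [inner_fourierLp_toLp_mul_fourier]
      split_ifs with hjk
      · rw [show ((j : ℤ) - k) = ((j - k : ℕ) : ℤ) by push_cast [Nat.cast_sub hjk]; ring,
          ← mul_assoc, ← pow_add, Nat.add_sub_cancel' hjk]
      · push Not at hjk
        obtain ⟨m, hm⟩ : ∃ m : ℕ, (j : ℤ) - k = -(m + 1 : ℤ) := ⟨k - j - 1, by omega⟩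
        rw [hm, hF m, mul_zero]
    simp only [hterm] at h1
    -- reindex `j = k + i`
    have h3 : HasSum (fun i : ℕ => x ^ k * (x ^ i * ⟪fourierLp (T := (1:ℝ)) 2 (i : ℤ),
        ContinuousMap.toLp (E := ℂ) 2 haarAddCircle ℂ F⟫_ℂ))
        ⟪etaVec 1 x, ContinuousMap.toLp (E := ℂ) 2 haarAddCircle ℂ (F * fourier (k : ℤ))⟫_ℂ := by
      have h4 := (hasSum_nat_add_iff' k).2 h1
      have hzero : ∑ i ∈ Finset.range k, (if k ≤ i then x ^ k * (x ^ (i - k) *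
          ⟪fourierLp (T := (1:ℝ)) 2 ((i - k : ℕ) : ℤ), ContinuousMap.toLp (E := ℂ) 2 haarAddCircle ℂ F⟫_ℂ)
          else 0) = 0 := Finset.sum_eq_zero fun i hi => by
        rw [Finset.mem_range] at hi; rw [if_neg (by omega)]
      rw [hzero, sub_zero] at h4
      refine h4.congr_fun fun i => ?_
      rw [if_pos (by omega), Nat.add_sub_cancel]
    have h5 := h2.mul_left (x ^ k)
    rw [h3.unique h5]
    ring
  -- conclude by density of the modes in `H²`
  have hspan : ∀ v ∈ Submodule.span ℂ (Set.range fun k : ℕ => fourierLp (T := (1:ℝ)) 2 (k : ℤ)),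
      L₁ v = L₂ v := by
    intro v hv
    exact LinearMap.eqOn_span' (f := L₁.toLinearMap) (g := L₂.toLinearMap)
      (by rintro _ ⟨k, rfl⟩; exact hmodes k) hv
  have hcl : ∀ v ∈ (Submodule.span ℂ
      (Set.range fun k : ℕ => fourierLp (T := (1:ℝ)) 2 (k : ℤ))).topologicalClosure, L₁ v = L₂ v := by
    intro v hv
    have hc : closure {v | L₁ v = L₂ v} = {v | L₁ v = L₂ v} :=
      (isClosed_eq L₁.continuous L₂.continuous).closure_eq
    have : v ∈ closure ((Submodule.span ℂ (Set.range fun k : ℕ => fourierLp (T := (1:ℝ)) 2 (k : ℤ)) :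
        Set (Lp ℂ 2 (haarAddCircle (T := (1:ℝ)))))) := hv
    exact (hc ▸ closure_mono hspan this :)
  have := hcl h (hardySpace_eq_topologicalClosure_span ▸ hh)
  simpa [L₁, L₂] using this

/-- RH-FREE. Function-level form of the multiplier statements: for `U` holomorphic across `S¹` and
`h ∈ H²`, `U|_{S¹}·h ∈ H²` and `⟨η_x | U|_{S¹}·h⟩ = U(x)⟨η_x | h⟩`.
[cite: ConnesConsani2021QuasiInner, §2, before Prop 2.4 (arXiv chunk p0006:L87–L88); Prop 3.7, proof (p0009:L54–p0010:L4)] -/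
theorem mulOp_boundary_of_differentiableOn_ball {U : ℂ → ℂ} {R : ℝ} (hR : 1 < R)
    (hU : DifferentiableOn ℂ U (ball 0 R)) {h : Lp ℂ 2 (haarAddCircle (T := (1:ℝ)))}
    (hh : h ∈ hardySpace 1) :
    mulOp haarAddCircle (toLpOrZero ∞ haarAddCircle (circleRestrict 1 U)) h ∈ hardySpace 1 ∧
    ∀ x : ℂ, ‖x‖ < 1 →
      ⟪etaVec 1 x, mulOp haarAddCircle (toLpOrZero ∞ haarAddCircle (circleRestrict 1 U)) h⟫_ℂ =
        U x * ⟪etaVec 1 x, h⟫_ℂ := by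
  set F : C(AddCircle (1:ℝ), ℂ) :=
    ⟨circleRestrict 1 U, continuous_circleRestrict_of_differentiableOn_ball hR hU⟩ with hFdef
  have hLp2 : toLpOrZero 2 haarAddCircle (circleRestrict 1 U) =
      ContinuousMap.toLp (E := ℂ) 2 haarAddCircle ℂ F := toLpOrZero_eq_toLp_continuousMap 2 F
  have hLpT : toLpOrZero ∞ haarAddCircle (circleRestrict 1 U) =
      ContinuousMap.toLp (E := ℂ) ∞ haarAddCircle ℂ F := toLpOrZero_eq_toLp_continuousMap ∞ F
  obtain ⟨-, hneg, heval⟩ := boundary_of_differentiableOn_ball hR hU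
  rw [hLp2] at hneg heval
  rw [hLpT]
  refine ⟨mulOp_mem_hardySpace_of_inner_neg_eq_zero F hneg hh, fun x hx => ?_⟩
  rw [inner_etaVec_mulOp F hneg hx hh, heval x hx]

/-! ### M3. A single Blaschke factor: holomorphy across `S¹`, unimodularity, Fourier expansion -/

/-- RH-FREE. `2/(1 + |α|) > 1` for `|α| < 1`. [folklore] -/
private theorem one_lt_two_div_one_add_norm {α : ℂ} (hα : ‖α‖ < 1) : 1 < 2 / (1 + ‖α‖) := by
  rw [lt_div_iff₀ (by positivity)]; linarith

/-- RH-FREE. For `|α| < 1` the Blaschke factor `b_α` is holomorphic on the disc of radius `2/(1+|α|) > 1`.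
[cite: ConnesConsani2021QuasiInner, §3 (arXiv chunk p0009:L38–L41)] -/
theorem differentiableOn_blaschkeFactor {α : ℂ} (hα : ‖α‖ < 1) :
    DifferentiableOn ℂ (blaschkeFactor α) (ball 0 (2 / (1 + ‖α‖))) := by
  intro v hv
  rw [mem_ball_zero_iff] at hv
  have hden : 1 - (starRingEnd ℂ) α * v ≠ 0 := by
    intro h0
    have h1 : ‖(starRingEnd ℂ) α * v‖ = 1 := by
      rw [sub_eq_zero] at h0; rw [← h0, norm_one]
    rw [norm_mul, RCLike.norm_conj] at h1
    have h2 : ‖α‖ * ‖v‖ ≤ ‖α‖ * (2 / (1 + ‖α‖)) :=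
      mul_le_mul_of_nonneg_left hv.le (norm_nonneg α)
    have h3 : ‖α‖ * (2 / (1 + ‖α‖)) < 1 := by
      rw [mul_div_assoc', div_lt_one (by positivity)]
      nlinarith [norm_nonneg α]
    linarith
  unfold blaschkeFactor
  apply DifferentiableAt.differentiableWithinAt
  apply DifferentiableAt.mul _ (differentiableAt_const _)
  exact DifferentiableAt.div (by fun_prop) (by fun_prop) hden

/-- RH-FREE. **`|b_α| = 1` on the circle** (`|α| < 1`, `α ≠ 0`): `|α − v| = |1 − ᾱv|` for `|v| = 1`.
[cite: ConnesConsani2021QuasiInner, §3 (arXiv chunk p0009:L38–L41)] -/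
theorem norm_blaschkeFactor_of_norm_eq_one {α v : ℂ} (hα : ‖α‖ < 1) (hα0 : α ≠ 0) (hv : ‖v‖ = 1) :
    ‖blaschkeFactor α v‖ = 1 := by
  have hden : 1 - (starRingEnd ℂ) α * v ≠ 0 := by
    intro h0
    rw [sub_eq_zero] at h0
    have : ‖(starRingEnd ℂ) α * v‖ = 1 := by rw [← h0, norm_one]
    rw [norm_mul, RCLike.norm_conj, hv, mul_one] at this
    linarith
  have hkey : ‖α - v‖ = ‖1 - (starRingEnd ℂ) α * v‖ := by
    have hvv : v * (starRingEnd ℂ) v = 1 := by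
      rw [Complex.mul_conj, Complex.normSq_eq_norm_sq, hv]; norm_num
    have e : 1 - (starRingEnd ℂ) α * v = v * (starRingEnd ℂ) (v - α) := by
      rw [map_sub, mul_sub, hvv]; ring
    rw [e, norm_mul, hv, one_mul, Complex.norm_conj, norm_sub_rev]
  unfold blaschkeFactor
  rw [norm_mul, norm_div, hkey, div_self (norm_ne_zero_iff.2 hden), one_mul, norm_div,
    Complex.norm_real, Real.norm_eq_abs, abs_norm, div_self (norm_ne_zero_iff.2 hα0)]

/-- RH-FREE. `b_α(α) = 0`. [cite: ConnesConsani2021QuasiInner, §3 (arXiv chunk p0009:L38–L41)] -/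
theorem blaschkeFactor_self (α : ℂ) : blaschkeFactor α α = 0 := by
  simp [blaschkeFactor]

/-- RH-FREE. `b_α(β) ≠ 0` for `β ≠ α` in the closed disc (`|α| < 1`, `α ≠ 0`).
[cite: ConnesConsani2021QuasiInner, §3 (arXiv chunk p0009:L38–L41)] -/
theorem blaschkeFactor_ne_zero {α β : ℂ} (hα : ‖α‖ < 1) (hα0 : α ≠ 0) (hβ : ‖β‖ ≤ 1) (hβα : β ≠ α) :
    blaschkeFactor α β ≠ 0 := by
  have hden : 1 - (starRingEnd ℂ) α * β ≠ 0 := by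
    intro h0
    rw [sub_eq_zero] at h0
    have : ‖(starRingEnd ℂ) α * β‖ = 1 := by rw [← h0, norm_one]
    rw [norm_mul, RCLike.norm_conj] at this
    nlinarith [norm_nonneg α, norm_nonneg β]
  unfold blaschkeFactor
  refine mul_ne_zero (div_ne_zero (sub_ne_zero.2 (Ne.symm hβα)) hden) (div_ne_zero ?_ hα0)
  exact_mod_cast norm_ne_zero_iff.2 hα0

/-- RH-FREE. The geometric Fourier series `Σ_k c^k e_k = (1 − cz)⁻¹` in `C(S¹)` (`|c| < 1`). [folklore] -/
private theorem hasSum_geometric_fourier (c : ℂ) (hc : ‖c‖ < 1) :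
    HasSum (fun k : ℕ => c ^ k • fourier (T := (1:ℝ)) (k : ℤ))
      (⟨fun x : AddCircle (1:ℝ) => (1 - c * (toCircle x : ℂ))⁻¹, by
        refine Continuous.inv₀ (by fun_prop) fun x h => ?_
        have h1 : ‖c * (toCircle x : ℂ)‖ < 1 := by
          rw [norm_mul, Circle.norm_coe, mul_one]; exact hc
        rw [sub_eq_zero] at h
        rw [← h, norm_one] at h1
        exact lt_irrefl _ h1⟩ : C(AddCircle (1:ℝ), ℂ)) := by
  have hsum : Summable fun k : ℕ => c ^ k • fourier (T := (1:ℝ)) (k : ℤ) := by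
    refine Summable.of_norm_bounded (g := fun k : ℕ => ‖c‖ ^ k) (summable_geometric_of_lt_one
      (norm_nonneg _) hc) fun k => ?_
    rw [norm_smul, fourier_norm, mul_one, norm_pow]
  convert hsum.hasSum using 1
  ext x
  have hx : ‖c * (toCircle x : ℂ)‖ < 1 := by
    rw [norm_mul, Circle.norm_coe, mul_one]; exact hc
  have h1 := (ContinuousMap.evalCLM ℂ x).hasSum hsum.hasSum
  simp only [ContinuousMap.evalCLM_apply, ContinuousMap.smul_apply, smul_eq_mul] at h1
  have h2 : HasSum (fun k : ℕ => (c * (toCircle x : ℂ)) ^ k) (1 - c * (toCircle x : ℂ))⁻¹ :=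
    hasSum_geometric_of_norm_lt_one hx
  have h3 : (fun k : ℕ => c ^ k * fourier (T := (1:ℝ)) (k : ℤ) x) = fun k => (c * (toCircle x : ℂ)) ^ k := by
    funext k
    rw [fourier_apply, toCircle_zsmul]; simp [mul_pow]
  rw [h3] at h1
  simp only [ContinuousMap.coe_mk]
  exact h2.unique h1

/-- RH-FREE. `b_α` restricted to `S¹` is continuous (`|α| < 1`). [cite: ConnesConsani2021QuasiInner, §3 (arXiv chunk p0009:L38–L41)] -/
theorem continuous_circleRestrict_blaschkeFactor {α : ℂ} (hα : ‖α‖ < 1) :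
    Continuous (circleRestrict 1 (blaschkeFactor α)) :=
  continuous_circleRestrict_of_differentiableOn_ball (one_lt_two_div_one_add_norm hα)
    (differentiableOn_blaschkeFactor hα)

/-- Partial fractions for a Blaschke factor: `b_α(v) − |α| = (|α|/α)(|α|² − 1) v (1 − ᾱv)⁻¹`. [folklore] -/
private theorem blaschkeFactor_sub_norm {α v : ℂ} (hden : 1 - (starRingEnd ℂ) α * v ≠ 0) :
    blaschkeFactor α v - ((‖α‖ : ℝ) : ℂ) =
      (‖α‖ : ℂ) / α * ((‖α‖ : ℂ) ^ 2 - 1) * v * (1 - (starRingEnd ℂ) α * v)⁻¹ := by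
  unfold blaschkeFactor
  by_cases hα0 : α = 0
  · subst hα0; simp
  · have hsq : ((‖α‖ : ℂ)) ^ 2 = α * (starRingEnd ℂ) α := by
      rw [Complex.mul_conj, Complex.normSq_eq_norm_sq]; push_cast; ring
    rw [div_eq_mul_inv, div_eq_mul_inv]
    have ha : α⁻¹ * α = 1 := inv_mul_cancel₀ hα0
    have hD : (1 - (starRingEnd ℂ) α * v)⁻¹ * (1 - (starRingEnd ℂ) α * v) = 1 := inv_mul_cancel₀ hden
    linear_combination (‖α‖ : ℂ) * ((1 - (starRingEnd ℂ) α * v)⁻¹ * (1 - (starRingEnd ℂ) α * v)) * ha +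
      (‖α‖ : ℂ) * hD - (‖α‖ : ℂ) * α⁻¹ * (1 - (starRingEnd ℂ) α * v)⁻¹ * v * hsq

/-- RH-FREE. **The Fourier expansion of `b_α` on `S¹`**: `b_α = |α| e_0 + (|α|/α)(|α|² − 1) Σ_{k≥0} ᾱ^k e_{k+1}`
(partial fractions: `b_α(v) = |α| + (|α|/α)(|α|² − 1) v (1 − ᾱv)⁻¹`).
[cite: ConnesConsani2021QuasiInner, §3 (arXiv chunk p0009:L38–L41)] -/
theorem hasSum_fourier_blaschkeFactor {α : ℂ} (hα : ‖α‖ < 1) :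
    HasSum (fun j : ℕ => (if j = 0 then ((‖α‖ : ℝ) : ℂ)
        else ((‖α‖ : ℂ) / α) * ((‖α‖ : ℂ) ^ 2 - 1) * (starRingEnd ℂ) α ^ (j - 1)) •
        fourier (T := (1:ℝ)) (j : ℤ))
      (⟨circleRestrict 1 (blaschkeFactor α), continuous_circleRestrict_blaschkeFactor hα⟩ :
        C(AddCircle (1:ℝ), ℂ)) := by
  set c : ℂ := (‖α‖ : ℂ) / α with hc
  set d : ℂ := c * ((‖α‖ : ℂ) ^ 2 - 1) with hd
  have hconj : ‖(starRingEnd ℂ) α‖ < 1 := by rwa [RCLike.norm_conj]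
  -- the geometric series `Σ_k ᾱ^k e_k = (1 − ᾱ z)⁻¹`, with a name for its (bundled) sum
  obtain ⟨G, hGfun, hG⟩ : ∃ G : C(AddCircle (1:ℝ), ℂ),
      (∀ x, G x = (1 - (starRingEnd ℂ) α * (toCircle x : ℂ))⁻¹) ∧
      HasSum (fun k : ℕ => (starRingEnd ℂ) α ^ k • fourier (T := (1:ℝ)) (k : ℤ)) G :=
    ⟨_, fun x => rfl, hasSum_geometric_fourier _ hconj⟩
  have hG1 := hG.mul_left (d • fourier (T := (1:ℝ)) 1)
  -- target summand, shifted by one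
  set g : ℕ → C(AddCircle (1:ℝ), ℂ) := fun j => (if j = 0 then ((‖α‖ : ℝ) : ℂ)
      else c * ((‖α‖ : ℂ) ^ 2 - 1) * (starRingEnd ℂ) α ^ (j - 1)) • fourier (T := (1:ℝ)) (j : ℤ) with hg
  have hshift : ∀ k : ℕ, g (k + 1) = (d • fourier (T := (1:ℝ)) 1) * ((starRingEnd ℂ) α ^ k •
      fourier (T := (1:ℝ)) (k : ℤ)) := by
    intro k
    simp only [hg, Nat.succ_ne_zero, if_false, Nat.add_sub_cancel, hd]
    rw [smul_mul_smul_comm]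
    congr 1
    ext x
    simp only [ContinuousMap.coe_mul, Pi.mul_apply]
    rw [show ((k + 1 : ℕ) : ℤ) = 1 + (k : ℤ) by push_cast; ring, fourier_add]
  rw [show (fun i : ℕ => (d • fourier (T := (1:ℝ)) 1) * ((starRingEnd ℂ) α ^ i •
      fourier (T := (1:ℝ)) (i : ℤ))) = (fun k => g (k + 1)) from (funext hshift).symm] at hG1
  rw [← hasSum_nat_add_iff' 1]
  simp only [Finset.range_one, Finset.sum_singleton]
  have hval : (⟨circleRestrict 1 (blaschkeFactor α), continuous_circleRestrict_blaschkeFactor hα⟩ :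
        C(AddCircle (1:ℝ), ℂ)) - g 0 = (d • fourier (T := (1:ℝ)) 1) * G := by
    ext x
    have hg0 : g 0 x = ((‖α‖ : ℝ) : ℂ) := by
      simp only [hg, if_true, ContinuousMap.smul_apply, smul_eq_mul]
      rw [show ((0 : ℕ) : ℤ) = 0 from rfl, fourier_zero]; simp
    rw [ContinuousMap.sub_apply, ContinuousMap.mul_apply, hg0, hGfun, ContinuousMap.smul_apply,
      smul_eq_mul, ContinuousMap.coe_mk]
    simp only [circleRestrict]
    have hv1 : ‖((toCircle x : Circle) : ℂ)‖ = 1 := Circle.norm_coe _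
    have hden : 1 - (starRingEnd ℂ) α * (toCircle x : ℂ) ≠ 0 := by
      intro h0
      rw [sub_eq_zero] at h0
      have : ‖(starRingEnd ℂ) α * (toCircle x : ℂ)‖ = 1 := by rw [← h0, norm_one]
      rw [norm_mul, RCLike.norm_conj, hv1, mul_one] at this
      linarith
    have hf1 : fourier (T := (1:ℝ)) 1 x = (toCircle x : ℂ) := by
      rw [fourier_apply, one_zsmul]
    rw [hf1, hd, hc]
    exact blaschkeFactor_sub_norm hden
  rw [hval]
  exact hG1

/-! ### M4. Unimodular continuous multipliers; division by one Blaschke factor (F. Riesz step) -/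

/-- `e_n` is the `L²` class of the character `fourier n`. [folklore] -/
private theorem fourierLp_eq_toLp (n : ℤ) :
    fourierLp (T := (1:ℝ)) 2 n = ContinuousMap.toLp (E := ℂ) 2 haarAddCircle ℂ (fourier n) := rfl

/-- Adjoint of a multiplication operator: `⟨g | F·f⟩ = ⟨F̄·g | f⟩`. [folklore] -/
private theorem inner_mulOp_toLp (F : C(AddCircle (1:ℝ), ℂ)) (f g : Lp ℂ 2 (haarAddCircle (T := (1:ℝ)))) :
    ⟪g, mulOp haarAddCircle (ContinuousMap.toLp (E := ℂ) ∞ haarAddCircle ℂ F) f⟫_ℂ =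
      ⟪mulOp haarAddCircle (ContinuousMap.toLp (E := ℂ) ∞ haarAddCircle ℂ (star F)) g, f⟫_ℂ := by
  rw [MeasureTheory.L2.inner_def, MeasureTheory.L2.inner_def]
  refine integral_congr_ae ?_
  filter_upwards [coeFn_mulOp haarAddCircle (ContinuousMap.toLp (E := ℂ) ∞ haarAddCircle ℂ F) f,
    coeFn_mulOp haarAddCircle (ContinuousMap.toLp (E := ℂ) ∞ haarAddCircle ℂ (star F)) g,
    ContinuousMap.coeFn_toLp (p := ∞) (𝕜 := ℂ) haarAddCircle F,
    ContinuousMap.coeFn_toLp (p := ∞) (𝕜 := ℂ) haarAddCircle (star F)] with x h1 h2 h3 h4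
  rw [h1, h2, h3, h4, ContinuousMap.star_apply, Complex.star_def, RCLike.inner_apply, RCLike.inner_apply,
    map_mul, Complex.conj_conj]
  ring

/-- Composition of multiplication operators by continuous functions. [folklore] -/
private theorem mulOp_toLp_mulOp_toLp (F G : C(AddCircle (1:ℝ), ℂ)) (f : Lp ℂ 2 (haarAddCircle (T := (1:ℝ)))) :
    mulOp haarAddCircle (ContinuousMap.toLp (E := ℂ) ∞ haarAddCircle ℂ F)
        (mulOp haarAddCircle (ContinuousMap.toLp (E := ℂ) ∞ haarAddCircle ℂ G) f) =
      mulOp haarAddCircle (ContinuousMap.toLp (E := ℂ) ∞ haarAddCircle ℂ (F * G)) f := by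
  apply Lp.ext
  filter_upwards [coeFn_mulOp haarAddCircle (ContinuousMap.toLp (E := ℂ) ∞ haarAddCircle ℂ F)
      (mulOp haarAddCircle (ContinuousMap.toLp (E := ℂ) ∞ haarAddCircle ℂ G) f),
    coeFn_mulOp haarAddCircle (ContinuousMap.toLp (E := ℂ) ∞ haarAddCircle ℂ G) f,
    coeFn_mulOp haarAddCircle (ContinuousMap.toLp (E := ℂ) ∞ haarAddCircle ℂ (F * G)) f,
    ContinuousMap.coeFn_toLp (p := ∞) (𝕜 := ℂ) haarAddCircle F,
    ContinuousMap.coeFn_toLp (p := ∞) (𝕜 := ℂ) haarAddCircle G,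
    ContinuousMap.coeFn_toLp (p := ∞) (𝕜 := ℂ) haarAddCircle (F * G)] with x h1 h2 h3 h4 h5 h6
  rw [h1, h2, h3, h4, h5, h6, ContinuousMap.mul_apply, mul_assoc]

/-- A unimodular continuous multiplier is undone by its conjugate: `F · (F̄ · f) = f`. [folklore] -/
private theorem mulOp_toLp_mulOp_star_self (F : C(AddCircle (1:ℝ), ℂ)) (hF : ∀ x, ‖F x‖ = 1)
    (f : Lp ℂ 2 (haarAddCircle (T := (1:ℝ)))) :
    mulOp haarAddCircle (ContinuousMap.toLp (E := ℂ) ∞ haarAddCircle ℂ F)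
        (mulOp haarAddCircle (ContinuousMap.toLp (E := ℂ) ∞ haarAddCircle ℂ (star F)) f) = f := by
  rw [mulOp_toLp_mulOp_toLp]
  apply Lp.ext
  filter_upwards [coeFn_mulOp haarAddCircle (ContinuousMap.toLp (E := ℂ) ∞ haarAddCircle ℂ (F * star F)) f,
    ContinuousMap.coeFn_toLp (p := ∞) (𝕜 := ℂ) haarAddCircle (F * star F)] with x h1 h2
  rw [h1, h2, ContinuousMap.mul_apply, ContinuousMap.star_apply, Complex.star_def, Complex.mul_conj,
    Complex.normSq_eq_norm_sq, hF x]
  simp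

/-- RH-FREE. **Division by a Blaschke factor (F. Riesz step)**: if `f ∈ H²` vanishes at `α` (`⟨η_α | f⟩ = 0`,
`|α| < 1`) then `b̄_α · f ∈ H²` — so that `f = b_α · (b̄_α f)` factors through `b_α H²` («the functions of
`H²(𝒰)` which vanish on all zeros of `B` hence … of the form `𝒫B𝒫 h`», one zero at a time).
[cite: ConnesConsani2021QuasiInner, Prop 3.7 (ii), proof (arXiv chunk p0010:L4–L7), citing Rudin, Real and Complex Analysis] -/
theorem mulOp_star_blaschkeFactor_mem_hardySpace {α : ℂ} (hα : ‖α‖ < 1)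
    {f : Lp ℂ 2 (haarAddCircle (T := (1:ℝ)))} (hf : f ∈ hardySpace 1) (hzero : ⟪etaVec 1 α, f⟫_ℂ = 0) :
    mulOp haarAddCircle (ContinuousMap.toLp (E := ℂ) ∞ haarAddCircle ℂ
      (star (⟨circleRestrict 1 (blaschkeFactor α), continuous_circleRestrict_blaschkeFactor hα⟩ :
        C(AddCircle (1:ℝ), ℂ)))) f ∈ hardySpace 1 := by
  set B : C(AddCircle (1:ℝ), ℂ) :=
    ⟨circleRestrict 1 (blaschkeFactor α), continuous_circleRestrict_blaschkeFactor hα⟩ with hB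
  set c : ℂ := (‖α‖ : ℂ) / α with hc
  set d : ℂ := c * ((‖α‖ : ℂ) ^ 2 - 1) with hd
  set q : ℕ → ℂ := fun j => if j = 0 then ((‖α‖ : ℝ) : ℂ)
      else c * ((‖α‖ : ℂ) ^ 2 - 1) * (starRingEnd ℂ) α ^ (j - 1) with hq
  have hBsum : HasSum (fun j : ℕ => q j • fourier (T := (1:ℝ)) (j : ℤ)) B := hasSum_fourier_blaschkeFactor hα
  rw [mem_hardySpace_iff]
  intro m
  rw [inner_mulOp_toLp, star_star, ← inner_conj_symm, fourierLp_eq_toLp, mulOp_toLp_toLp]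
  -- it remains to see `⟨f | b_α e_{−m−1}⟩ = 0`
  set S := ⟪f, ContinuousMap.toLp (E := ℂ) 2 haarAddCircle ℂ (B * fourier (-(m + 1 : ℤ)))⟫_ℂ with hS
  suffices h0 : S = 0 by rw [h0, map_zero]
  -- `b_α e_{−m−1} = Σ_j q_j e_{j−m−1}` in `L²`
  have h1 : HasSum (fun j : ℕ => q j • fourierLp (T := (1:ℝ)) 2 ((j : ℤ) - (m + 1)))
      (ContinuousMap.toLp (E := ℂ) 2 haarAddCircle ℂ (B * fourier (-(m + 1 : ℤ)))) := by
    have h2 := (ContinuousMap.toLp (E := ℂ) 2 haarAddCircle ℂ).hasSum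
      (hBsum.mul_right (fourier (T := (1:ℝ)) (-(m + 1 : ℤ))))
    refine h2.congr_fun fun j => ?_
    have e : fourier (T := (1:ℝ)) (j : ℤ) * fourier (T := (1:ℝ)) (-(m + 1 : ℤ)) =
        fourier (T := (1:ℝ)) ((j : ℤ) - (m + 1)) := by
      ext x
      rw [ContinuousMap.mul_apply, sub_eq_add_neg, fourier_add]
    show q j • fourierLp (T := (1:ℝ)) 2 ((j : ℤ) - (m + 1)) =
      (ContinuousMap.toLp (E := ℂ) 2 haarAddCircle ℂ) ((q j • fourier (T := (1:ℝ)) (j : ℤ)) * fourier (-(m + 1 : ℤ)))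
    rw [smul_mul_assoc, map_smul, e, fourierLp_eq_toLp]
  have h4 := (innerSL ℂ f).hasSum h1
  simp only [innerSL_apply_apply, inner_smul_right] at h4
  -- the first `m + 1` terms vanish (`f ∈ H²`), the rest is `d ᾱ^m · conj ⟨η_α | f⟩ = 0`
  have h5 := (hasSum_nat_add_iff' (m + 1)).2 h4
  have hvan : ∀ j < m + 1, ⟪f, fourierLp (T := (1:ℝ)) 2 ((j : ℤ) - (m + 1))⟫_ℂ = 0 := by
    intro j hj
    obtain ⟨n, hn⟩ : ∃ n : ℕ, (j : ℤ) - (m + 1) = -(n + 1 : ℤ) := ⟨m - j, by omega⟩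
    rw [hn, inner_eq_zero_symm]
    exact (mem_hardySpace_iff 1 f).1 hf n
  have hfin : ∑ j ∈ Finset.range (m + 1), q j * ⟪f, fourierLp (T := (1:ℝ)) 2 ((j : ℤ) - (m + 1))⟫_ℂ = 0 :=
    Finset.sum_eq_zero fun j hj => by rw [hvan j (Finset.mem_range.1 hj), mul_zero]
  rw [hfin, sub_zero] at h5
  have h6 : HasSum (fun i : ℕ => (d * (starRingEnd ℂ) α ^ m) *
      ((starRingEnd ℂ) α ^ i * ⟪f, fourierLp (T := (1:ℝ)) 2 (i : ℤ)⟫_ℂ)) S := by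
    refine h5.congr_fun fun i => ?_
    have hi : ((i + (m + 1) : ℕ) : ℤ) - (m + 1) = (i : ℤ) := by push_cast; ring
    have hqi : q (i + (m + 1)) = d * (starRingEnd ℂ) α ^ (i + m) := by
      rw [hq]
      simp only
      rw [if_neg (by omega), show i + (m + 1) - 1 = i + m by omega, hd]
    rw [hi, hqi, pow_add]
    ring
  have h7 := inner_etaVec_eq_tsum α hα f
  rw [hzero] at h7
  have h8 := h7.star
  simp only [Complex.star_def, map_mul, map_pow, inner_conj_symm, star_zero] at h8
  have h9 := h8.mul_left (d * (starRingEnd ℂ) α ^ m)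
  rw [mul_zero] at h9
  exact h6.unique h9

/-! ### M5. Finite Blaschke products: holomorphy across `S¹`, unimodularity, multiplier and division -/

/-- RH-FREE. A finite Blaschke product is holomorphic on a disc of radius `> 1`.
[cite: ConnesConsani2021QuasiInner, §3 (arXiv chunk p0009:L38–L41)] -/
theorem exists_differentiableOn_blaschkeProd (s : Finset ℂ) (hs : ∀ α ∈ s, ‖α‖ < 1) :
    ∃ R : ℝ, 1 < R ∧ DifferentiableOn ℂ (fun v => ∏ α ∈ s, blaschkeFactor α v) (ball 0 R) := by
  classical
  induction s using Finset.induction_on with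
  | empty => exact ⟨2, one_lt_two, by simp only [Finset.prod_empty]; exact differentiableOn_const _⟩
  | insert a s ha ih =>
    obtain ⟨R, hR1, hR⟩ := ih fun α hα' => hs α (Finset.mem_insert_of_mem hα')
    have haa := hs a (Finset.mem_insert_self a s)
    refine ⟨min R (2 / (1 + ‖a‖)), lt_min hR1 (one_lt_two_div_one_add_norm haa), ?_⟩
    have e : (fun v => ∏ α ∈ insert a s, blaschkeFactor α v) =
        fun v => blaschkeFactor a v * ∏ α ∈ s, blaschkeFactor α v := funext fun v => Finset.prod_insert ha
    rw [e]
    exact ((differentiableOn_blaschkeFactor haa).mono (ball_subset_ball (min_le_right _ _))).mul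
      (hR.mono (ball_subset_ball (min_le_left _ _)))

/-- RH-FREE. A finite Blaschke product restricted to `S¹` is continuous.
[cite: ConnesConsani2021QuasiInner, §3 (arXiv chunk p0009:L38–L41)] -/
theorem continuous_circleRestrict_blaschkeProd (s : Finset ℂ) (hs : ∀ α ∈ s, ‖α‖ < 1) :
    Continuous (circleRestrict 1 fun v => ∏ α ∈ s, blaschkeFactor α v) := by
  obtain ⟨R, hR1, hR⟩ := exists_differentiableOn_blaschkeProd s hs
  exact continuous_circleRestrict_of_differentiableOn_ball hR1 hR

/-- RH-FREE. A finite Blaschke product (nonzero zeros) is unimodular on `S¹`.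
[cite: ConnesConsani2021QuasiInner, §3 (arXiv chunk p0009:L38–L41)] -/
theorem norm_blaschkeProd_of_norm_eq_one (s : Finset ℂ) (hs : ∀ α ∈ s, ‖α‖ < 1 ∧ α ≠ 0) {v : ℂ}
    (hv : ‖v‖ = 1) : ‖∏ α ∈ s, blaschkeFactor α v‖ = 1 := by
  rw [norm_prod]
  exact Finset.prod_eq_one fun α hα => norm_blaschkeFactor_of_norm_eq_one (hs α hα).1 (hs α hα).2 hv

/-- RH-FREE. **Finite Blaschke products are `H²`-multipliers with multiplicative evaluation**:
`B_s · h ∈ H²` and `⟨η_x | B_s h⟩ = B_s(x) ⟨η_x | h⟩` for `h ∈ H²`, `|x| < 1`.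
[cite: ConnesConsani2021QuasiInner, Prop 3.7 (ii), proof (arXiv chunk p0009:L54–p0010:L7)] -/
theorem mulOp_blaschkeProd_mem_hardySpace (s : Finset ℂ) (hs : ∀ α ∈ s, ‖α‖ < 1)
    {h : Lp ℂ 2 (haarAddCircle (T := (1:ℝ)))} (hh : h ∈ hardySpace 1) :
    mulOp haarAddCircle (ContinuousMap.toLp (E := ℂ) ∞ haarAddCircle ℂ
      (⟨circleRestrict 1 fun v => ∏ α ∈ s, blaschkeFactor α v, continuous_circleRestrict_blaschkeProd s hs⟩ :
        C(AddCircle (1:ℝ), ℂ))) h ∈ hardySpace 1 ∧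
    ∀ x : ℂ, ‖x‖ < 1 →
      ⟪etaVec 1 x, mulOp haarAddCircle (ContinuousMap.toLp (E := ℂ) ∞ haarAddCircle ℂ
        (⟨circleRestrict 1 fun v => ∏ α ∈ s, blaschkeFactor α v, continuous_circleRestrict_blaschkeProd s hs⟩ :
          C(AddCircle (1:ℝ), ℂ))) h⟫_ℂ = (∏ α ∈ s, blaschkeFactor α x) * ⟪etaVec 1 x, h⟫_ℂ := by
  obtain ⟨R, hR1, hR⟩ := exists_differentiableOn_blaschkeProd s hs
  have key := mulOp_boundary_of_differentiableOn_ball hR1 hR hh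
  set F : C(AddCircle (1:ℝ), ℂ) :=
    ⟨circleRestrict 1 fun v => ∏ α ∈ s, blaschkeFactor α v, continuous_circleRestrict_blaschkeProd s hs⟩ with hF
  have e : toLpOrZero ∞ haarAddCircle (circleRestrict 1 fun v => ∏ α ∈ s, blaschkeFactor α v) =
      ContinuousMap.toLp (E := ℂ) ∞ haarAddCircle ℂ F :=
    toLpOrZero_eq_toLp_continuousMap ∞ F
  rwa [e] at key

/-- RH-FREE. **Division by a finite Blaschke product (F. Riesz)**: if `f ∈ H²` vanishes at every `α ∈ s`
(`⟨η_α | f⟩ = 0`; `0 < |α| < 1`) then `B̄_s · f ∈ H²` and `f = B_s · (B̄_s f)` («the functions of `H²(𝒰)`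
which vanish on all zeros of `B` … of the form `𝒫B𝒫 h`», finite stage).
[cite: ConnesConsani2021QuasiInner, Prop 3.7 (ii), proof (arXiv chunk p0010:L4–L7), citing Rudin, Real and Complex Analysis] -/
theorem mulOp_star_blaschkeProd_mem_hardySpace (s : Finset ℂ) (hs : ∀ α ∈ s, ‖α‖ < 1 ∧ α ≠ 0)
    {f : Lp ℂ 2 (haarAddCircle (T := (1:ℝ)))} (hf : f ∈ hardySpace 1)
    (hzero : ∀ α ∈ s, ⟪etaVec 1 α, f⟫_ℂ = 0) :
    mulOp haarAddCircle (ContinuousMap.toLp (E := ℂ) ∞ haarAddCircle ℂ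
      (star (⟨circleRestrict 1 fun v => ∏ α ∈ s, blaschkeFactor α v,
        continuous_circleRestrict_blaschkeProd s fun α hα => (hs α hα).1⟩ : C(AddCircle (1:ℝ), ℂ)))) f
      ∈ hardySpace 1 ∧
    mulOp haarAddCircle (ContinuousMap.toLp (E := ℂ) ∞ haarAddCircle ℂ
      (⟨circleRestrict 1 fun v => ∏ α ∈ s, blaschkeFactor α v,
        continuous_circleRestrict_blaschkeProd s fun α hα => (hs α hα).1⟩ : C(AddCircle (1:ℝ), ℂ)))
      (mulOp haarAddCircle (ContinuousMap.toLp (E := ℂ) ∞ haarAddCircle ℂ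
        (star (⟨circleRestrict 1 fun v => ∏ α ∈ s, blaschkeFactor α v,
          continuous_circleRestrict_blaschkeProd s fun α hα => (hs α hα).1⟩ : C(AddCircle (1:ℝ), ℂ)))) f) = f := by
  classical
  refine ⟨?_, mulOp_toLp_mulOp_star_self _ (fun x => ?_) f⟩
  swap
  · exact norm_blaschkeProd_of_norm_eq_one s hs (Circle.norm_coe _)
  -- induction on the set of zeros
  induction s using Finset.induction_on generalizing f with
  | empty =>
    have e : (star (⟨circleRestrict 1 fun v => ∏ α ∈ (∅ : Finset ℂ), blaschkeFactor α v,
        continuous_circleRestrict_blaschkeProd ∅ fun α hα => (hs α hα).1⟩ : C(AddCircle (1:ℝ), ℂ))) = 1 := by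
      ext x; simp [circleRestrict]
    rw [e]
    have e2 : mulOp haarAddCircle (ContinuousMap.toLp (E := ℂ) ∞ haarAddCircle ℂ (1 : C(AddCircle (1:ℝ), ℂ))) f
        = f := by
      apply Lp.ext
      filter_upwards [coeFn_mulOp haarAddCircle (ContinuousMap.toLp (E := ℂ) ∞ haarAddCircle ℂ
          (1 : C(AddCircle (1:ℝ), ℂ))) f,
        ContinuousMap.coeFn_toLp (p := ∞) (𝕜 := ℂ) haarAddCircle (1 : C(AddCircle (1:ℝ), ℂ))] with x h1 h2
      rw [h1, h2, ContinuousMap.one_apply, one_mul]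
    rw [e2]; exact hf
  | insert a s ha ih =>
    have hs' : ∀ α ∈ s, ‖α‖ < 1 ∧ α ≠ 0 := fun α hα => hs α (Finset.mem_insert_of_mem hα)
    have haa := hs a (Finset.mem_insert_self a s)
    -- divide by `B_s` first
    set Bs : C(AddCircle (1:ℝ), ℂ) := ⟨circleRestrict 1 fun v => ∏ α ∈ s, blaschkeFactor α v,
      continuous_circleRestrict_blaschkeProd s fun α hα => (hs' α hα).1⟩ with hBs
    have ih1 : mulOp haarAddCircle (ContinuousMap.toLp (E := ℂ) ∞ haarAddCircle ℂ (star Bs)) f ∈ hardySpace 1 :=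
      ih hs' hf (fun α hα => hzero α (Finset.mem_insert_of_mem hα))
    set h₁ := mulOp haarAddCircle (ContinuousMap.toLp (E := ℂ) ∞ haarAddCircle ℂ (star Bs)) f with hh₁
    have hrec : mulOp haarAddCircle (ContinuousMap.toLp (E := ℂ) ∞ haarAddCircle ℂ Bs) h₁ = f :=
      mulOp_toLp_mulOp_star_self Bs (fun x => norm_blaschkeProd_of_norm_eq_one s hs' (Circle.norm_coe _)) f
    -- `h₁` still vanishes at `a`: `0 = ⟨η_a | f⟩ = B_s(a) ⟨η_a | h₁⟩` with `B_s(a) ≠ 0`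
    have heval := (mulOp_blaschkeProd_mem_hardySpace s (fun α hα => (hs' α hα).1) ih1).2 a haa.1
    rw [hrec, hzero a (Finset.mem_insert_self a s)] at heval
    have hBa : ∏ α ∈ s, blaschkeFactor α a ≠ 0 :=
      Finset.prod_ne_zero_iff.2 fun α hα =>
        blaschkeFactor_ne_zero (hs' α hα).1 (hs' α hα).2 haa.1.le (fun h => ha (h ▸ hα))
    have hzero₁ : ⟪etaVec 1 a, h₁⟫_ℂ = 0 := by
      rcases mul_eq_zero.1 heval.symm with h0 | h0
      · exact absurd h0 hBa
      · exact h0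
    -- divide `h₁` by `b_a`
    have h2 := mulOp_star_blaschkeFactor_mem_hardySpace haa.1 ih1 hzero₁
    set Ba : C(AddCircle (1:ℝ), ℂ) :=
      ⟨circleRestrict 1 (blaschkeFactor a), continuous_circleRestrict_blaschkeFactor haa.1⟩ with hBa'
    rw [mulOp_toLp_mulOp_toLp] at h2
    -- `b̄_a B̄_s = conj (B_{insert a s})`
    have e : star Ba * star Bs = star (⟨circleRestrict 1 fun v => ∏ α ∈ insert a s, blaschkeFactor α v,
        continuous_circleRestrict_blaschkeProd (insert a s) fun α hα => (hs α hα).1⟩ : C(AddCircle (1:ℝ), ℂ)) := by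
      ext x
      simp only [hBa', hBs, ContinuousMap.mul_apply, ContinuousMap.star_apply, ContinuousMap.coe_mk,
        circleRestrict]
      rw [Finset.prod_insert ha, star_mul']
    rw [e] at h2
    exact h2

end QuasiInner

end Literature.NumberTheory.ConnesConsani2021
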